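import Literature.AnabelianGeometry.SemiGraphs.TemperedCoverings

/-!
# The underlying semi-graph of a covering ([SemiAnbd] §2 p. 23, §3 p. 37)

Mochizuki, *Semi-graphs of anabelioids*, §2 p. 23 (finite étale coverings `𝒢' → 𝒢` of a
semi-graph of anabelioids: "the vertices `v'` (respectively, edges `e'`) of `𝔾'` [over `v`, `e`] are
the elements of the set of connected components" of the fibres) and §3 p. 37 ("we may associate, in
a natural way, to any object of `B^cov(𝒢)` a morphism of countable semi-graphs of anabelioids
`𝒢' → 𝒢`"; used on p. 38: "the underlying semi-graph `𝔾_i` of `𝒢_i`").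

For an object `S` of `B^cov(𝒢)` (`TemperedCoverings.lean`) this file constructs the underlying
semi-graph `S.orbitGraph` of the covering `𝒢_S → 𝒢`: vertices over `v` = the `Π_v`-orbits of
`S_v`, edges over `e` = the `Π_e`-orbits of `S_e`, the branches of an edge-orbit over `e` = the
branches of `e`, the branch over `b : e → v` of the orbit of `y ∈ S_e` abutting to the orbit of
`glue_b(y) ∈ S_v` (well defined: the gluing is `b_*`-equivariant); and the structure morphism
`S.orbitGraphProj : S.orbitGraph ⟶ 𝒢.graph`.
-/

namespace Literature.AnabelianGeometry.SemiGraphs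

namespace ProfiniteSemiGraph

open CategoryTheory

universe u

variable {𝒢 : ProfiniteSemiGraph.{u}} (S : CovObj 𝒢)

/-- Two points of vertex fibres lie in the same `Π_v`-orbit. [cite: MochizukiSemiAnbd2006, Def 3.5(i) p.37] -/
inductive CovObj.VRel : (Σ v : 𝒢.graph.Vertex, (S.SV v).obj.V) →
    (Σ v : 𝒢.graph.Vertex, (S.SV v).obj.V) → Prop
  | mk (v : 𝒢.graph.Vertex) (g : 𝒢.Gv v) (x : (S.SV v).obj.V) : CovObj.VRel ⟨v, x⟩ ⟨v, (S.SV v).obj.ρ g x⟩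

/-- Two points of edge fibres lie in the same `Π_e`-orbit. [cite: MochizukiSemiAnbd2006, Def 3.5(i) p.37] -/
inductive CovObj.ERel : (Σ e : 𝒢.graph.Edge, (S.SE e).obj.V) →
    (Σ e : 𝒢.graph.Edge, (S.SE e).obj.V) → Prop
  | mk (e : 𝒢.graph.Edge) (g : 𝒢.Ge e) (y : (S.SE e).obj.V) : CovObj.ERel ⟨e, y⟩ ⟨e, (S.SE e).obj.ρ g y⟩

/-- The vertices of the underlying semi-graph of the covering `S`: orbits of the `Π_v` on the `S_v`.
[cite: MochizukiSemiAnbd2006, Def 3.5(i) p.37] -/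
def CovObj.OVertex : Type u := Quot S.VRel

/-- The edges of the underlying semi-graph of `S`: orbits of the `Π_e` on the `S_e`.
[cite: MochizukiSemiAnbd2006, Def 3.5(i) p.37] -/
def CovObj.OEdge : Type u := Quot S.ERel

/-- The vertex of `𝒢` under a vertex-orbit. [cite: MochizukiSemiAnbd2006, Def 3.5(i) p.37] -/
def CovObj.OVertex.base : S.OVertex → 𝒢.graph.Vertex :=
  Quot.lift Sigma.fst (by rintro _ _ ⟨v, g, x⟩; rfl)

/-- The edge of `𝒢` under an edge-orbit. [cite: MochizukiSemiAnbd2006, Def 3.5(i) p.37] -/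
def CovObj.OEdge.base : S.OEdge → 𝒢.graph.Edge :=
  Quot.lift Sigma.fst (by rintro _ _ ⟨e, g, y⟩; rfl)

/-- The gluing along a branch `b : e → v`, on points of the edge fibre over `e = edgeOf b`
(presented as points of the total edge fibre with a proof that they lie over `edgeOf b`).
[cite: MochizukiSemiAnbd2006, Def 3.5(i) p.37] -/
def CovObj.glueV (b : 𝒢.graph.Branch) (v : 𝒢.graph.Vertex) (h : 𝒢.graph.abuts b = some v) :
    (p : Σ e : 𝒢.graph.Edge, (S.SE e).obj.V) → p.1 = 𝒢.graph.edgeOf b → (S.SV v).obj.V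
  | ⟨_, y⟩, rfl => (S.glue b v h).hom.hom.hom y

/-- Equivariance of the gluing: `glue_b (g · y) = b_*(g) · glue_b (y)`.
[cite: MochizukiSemiAnbd2006, Def 3.5(i) p.37] -/
theorem CovObj.glue_ρ (b : 𝒢.graph.Branch) (v : 𝒢.graph.Vertex) (h : 𝒢.graph.abuts b = some v)
    (g : 𝒢.Ge (𝒢.graph.edgeOf b)) (y : (S.SE (𝒢.graph.edgeOf b)).obj.V) :
    (S.glue b v h).hom.hom.hom ((S.SE (𝒢.graph.edgeOf b)).obj.ρ g y) =
      (S.SV v).obj.ρ (𝒢.brHom b v h g) ((S.glue b v h).hom.hom.hom y) :=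
  ConcreteCategory.congr_hom ((S.glue b v h).hom.hom.comm g) y

open Classical in
/-- The vertex-orbit to which the branch over `b : e → v` of an edge-orbit abuts (`none` if the
edge-orbit does not lie over the edge of `b`). [cite: MochizukiSemiAnbd2006, Def 3.5(i) p.37] -/
noncomputable def CovObj.glueOpt (b : 𝒢.graph.Branch) (v : 𝒢.graph.Vertex)
    (h : 𝒢.graph.abuts b = some v) : S.OEdge → Option S.OVertex :=
  Quot.lift (fun p => if hp : p.1 = 𝒢.graph.edgeOf b then
      some (Quot.mk _ ⟨v, S.glueV b v h p hp⟩) else none)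
    (by
      rintro _ _ ⟨e, g, y⟩
      by_cases he : e = 𝒢.graph.edgeOf b
      · subst he
        rw [dif_pos rfl, dif_pos rfl]
        refine congrArg some (Quot.sound ?_)
        have := CovObj.VRel.mk (S := S) v (𝒢.brHom b v h g) ((S.glue b v h).hom.hom.hom y)
        rw [← S.glue_ρ b v h g y] at this
        exact this
      · rw [dif_neg he, dif_neg he])

/-- The value of `glueOpt` on an orbit over the edge of `b`. [cite: MochizukiSemiAnbd2006, Def 3.5(i) p.37] -/
theorem CovObj.glueOpt_mk (b : 𝒢.graph.Branch) (v : 𝒢.graph.Vertex) (h : 𝒢.graph.abuts b = some v)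
    (y : (S.SE (𝒢.graph.edgeOf b)).obj.V) :
    S.glueOpt b v h (Quot.mk _ ⟨𝒢.graph.edgeOf b, y⟩) =
      some (Quot.mk _ ⟨v, (S.glue b v h).hom.hom.hom y⟩) :=
  dif_pos rfl

/-- `glueOpt` lands in orbits over `v`. [cite: MochizukiSemiAnbd2006, Def 3.5(i) p.37] -/
theorem CovObj.base_of_glueOpt_eq_some (b : 𝒢.graph.Branch) (v : 𝒢.graph.Vertex)
    (h : 𝒢.graph.abuts b = some v) (E : S.OEdge) (V : S.OVertex)
    (hV : S.glueOpt b v h E = some V) : CovObj.OVertex.base S V = v := by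
  induction E using Quot.ind with
  | mk p =>
    obtain ⟨e, y⟩ := p
    by_cases he : e = 𝒢.graph.edgeOf b
    · subst he
      rw [S.glueOpt_mk] at hV
      rw [← Option.some.inj hV]
      rfl
    · have : S.glueOpt b v h (Quot.mk _ ⟨e, y⟩) = none := dif_neg he
      rw [this] at hV
      exact absurd hV (by simp)

/-- `glueOpt` is defined (`some`) on orbits over the edge of `b`. [cite: MochizukiSemiAnbd2006, Def 3.5(i) p.37] -/
theorem CovObj.glueOpt_isSome (b : 𝒢.graph.Branch) (v : 𝒢.graph.Vertex)
    (h : 𝒢.graph.abuts b = some v) (E : S.OEdge) (hE : CovObj.OEdge.base S E = 𝒢.graph.edgeOf b) :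
    (S.glueOpt b v h E).isSome := by
  induction E using Quot.ind with
  | mk p =>
    obtain ⟨e, y⟩ := p
    cases hE
    rw [S.glueOpt_mk]
    rfl

/-- **The underlying semi-graph `𝔾_S` of the covering of `𝒢` given by an object `S` of `B^cov(𝒢)`**
(p. 23 / p. 37): vertices and edges are the orbits of the constituent actions, the branches of an
edge-orbit over `e` are the branches of `e`, abutting through the gluings.
[cite: MochizukiSemiAnbd2006, Def 3.5(i) p.37] -/
noncomputable def CovObj.orbitGraph : SemiGraph.{u} where
  Vertex := S.OVertex
  Edge := S.OEdge
  Branch := {p : 𝒢.graph.Branch × S.OEdge // CovObj.OEdge.base S p.2 = 𝒢.graph.edgeOf p.1}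
  edgeOf := fun p => p.1.2
  abuts := fun p => (𝒢.graph.abuts p.1.1).pbind fun v hv => S.glueOpt p.1.1 v (Option.mem_def.mp hv) p.1.2
  two_branches := by
    intro E
    induction E using Quot.ind with
    | mk q =>
      obtain ⟨e, y⟩ := q
      obtain ⟨b₁, b₂, hne, h₁, h₂, hall⟩ := 𝒢.graph.two_branches e
      refine ⟨⟨(b₁, Quot.mk _ ⟨e, y⟩), h₁.symm⟩, ⟨(b₂, Quot.mk _ ⟨e, y⟩), h₂.symm⟩, ?_, rfl, rfl, ?_⟩
      · intro h
        exact hne (congrArg (fun p : {p : 𝒢.graph.Branch × S.OEdge //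
          CovObj.OEdge.base S p.2 = 𝒢.graph.edgeOf p.1} => p.1.1) h)
      · rintro ⟨⟨b, E⟩, hE⟩ (hb : E = Quot.mk _ ⟨e, y⟩)
        subst hb
        rcases hall b hE.symm with rfl | rfl
        · exact Or.inl rfl
        · exact Or.inr rfl

/-- The coincidence map of `𝔾_S`, unfolded. [cite: MochizukiSemiAnbd2006, Def 3.5(i) p.37] -/
theorem CovObj.orbitGraph_abuts (p : S.orbitGraph.Branch) :
    S.orbitGraph.abuts p = (𝒢.graph.abuts p.1.1).pbind
      fun v hv => S.glueOpt p.1.1 v (Option.mem_def.mp hv) p.1.2 := rfl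

/-- A branch of `𝔾_S` over a branch `b` of `𝔾` abutting to `v` abuts to the orbit `glue_b` of its
edge-orbit. [cite: MochizukiSemiAnbd2006, Def 3.5(i) p.37] -/
theorem CovObj.orbitGraph_abuts_of_abuts (b : 𝒢.graph.Branch) (E : S.OEdge)
    (hE : CovObj.OEdge.base S E = 𝒢.graph.edgeOf b) (v : 𝒢.graph.Vertex)
    (hv : 𝒢.graph.abuts b = some v) :
    S.orbitGraph.abuts ⟨(b, E), hE⟩ = S.glueOpt b v hv E := by
  rw [S.orbitGraph_abuts]
  change (𝒢.graph.abuts b).pbind _ = _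
  simp only [hv, Option.pbind_some]

/-- A branch of `𝔾_S` over a branch of `𝔾` abutting to no vertex abuts to no vertex.
[cite: MochizukiSemiAnbd2006, Def 3.5(i) p.37] -/
theorem CovObj.orbitGraph_abuts_of_none (b : 𝒢.graph.Branch) (E : S.OEdge)
    (hE : CovObj.OEdge.base S E = 𝒢.graph.edgeOf b) (hv : 𝒢.graph.abuts b = none) :
    S.orbitGraph.abuts ⟨(b, E), hE⟩ = none := by
  rw [S.orbitGraph_abuts]
  change (𝒢.graph.abuts b).pbind _ = _
  simp only [hv]
  rfl

/-- The structure morphism `𝔾_S → 𝔾` of the underlying semi-graph of a covering.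
[cite: MochizukiSemiAnbd2006, Def 3.5(i) p.37] -/
noncomputable def CovObj.orbitGraphProj : S.orbitGraph ⟶ 𝒢.graph where
  vertexMap := CovObj.OVertex.base S
  edgeMap := CovObj.OEdge.base S
  branchMap := fun p => p.1.1
  edgeOf_branchMap := fun p => p.2.symm
  branchMap_injOn := by
    rintro ⟨⟨b₁, E₁⟩, h₁⟩ ⟨⟨b₂, E₂⟩, h₂⟩ (hE : E₁ = E₂) (hb : b₁ = b₂)
    subst hE; subst hb; rfl
  abuts_branchMap := by
    rintro ⟨⟨b, E⟩, hE⟩ V h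
    change 𝒢.graph.abuts b = some (CovObj.OVertex.base S V)
    rcases hab : 𝒢.graph.abuts b with _ | v
    · rw [S.orbitGraph_abuts_of_none b E hE hab] at h
      exact absurd h (by simp)
    · rw [S.orbitGraph_abuts_of_abuts b E hE v hab] at h
      rw [S.base_of_glueOpt_eq_some b v hab E V h]

end ProfiniteSemiGraph

end Literature.AnabelianGeometry.SemiGraphs
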